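import Literature.NumberTheory.LFunctions.VonKochTheorem
import Literature.NumberTheory.LFunctions.PerronTruncatedDedekind
import Literature.NumberTheory.LFunctions.DedekindZetaPartialFraction
import Literature.NumberTheory.LFunctions.ExplicitFormulaZeroSegment
import HarnessLib

/-!
# GRH implies `ψ_K(x) = x + O(√x log x (log|d_K| + n_K log x))`, uniformly in `K` (Lagarias–Odlyzko)

Topic `Literature/NumberTheory/LFunctions` (namespace `Literature.NumberTheory.LFunctions`).
Everything in this file is PROVED; there are no named facts. The only hypothesis is the Extended
Riemann Hypothesis for the field (`NumberField.ExtendedRiemannHypothesis K`, an open conjecture).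

**Theorem** (Lagarias–Odlyzko 1977, Thm. 9.1 / (9.2) for `L = K`, `C = G = {1}`, under GRH;
explicitly Winckler 2013, Thm. 8.1; Serre 1981, Thm. 4). There is an absolute constant `c` such that
for every number field `K` whose Dedekind zeta function satisfies GRH and every `x ≥ 2`,

  `|ψ_K(x) − x| ≤ c √x · log x · (log|d_K| + [K:ℚ] log x)`

(`exists_abs_chebyshevPsiIdeal_sub_self_le_of_erh`). This is the `ψ`-form hypothesis of the tree's
`NumberField.effectivePrimeIdealTheorem_of_ERH_of_chebyshevPsiIdeal`
(`EffectivePrimeIdealTheoremGRHFromPsi.lean`).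

**Proof** — the tree's von Koch contour (`VonKochTheorem.lean`, Montgomery–Vaughan §13.1 with the
contour of §12.1 stopped at `σ = 1/4`) run for the entire function `ζ₁_K(s) = (s − 1)ζ_K(s)`
(`dedekindZeta₁ K`) with every constant made uniform in `K` through the disc bound
`M_K(t) = log|d_K| + 3n_K + (n_K+1) log(|t|+7)` (`discBound K t`):
1. residues on `R = [1/4, c] × [T₂, T₁]`, `c = 1 + 1/log x`, `x = N + 1/2`
   (`rectBoundaryIntegral_dedekindVonKoch_eq`, weighted argument principle
   `Literature.Analysis.Complex.integral_boundary_rect_logDeriv_mul`): `∮ F = 2πi(x − ∑ m(ρ)x^ρ/ρ)` for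
   `F(s) = (−ζ₁_K'/ζ₁_K(s) + 1/(s−1)) x^s/s = (−ζ_K'/ζ_K)(s) x^s/s`;
2. right side `= 2π ψ_K(x) + O(n_K x log²x / T₀)` with `T₀ = √x + 2 ≤ |T_i|`
   (`NumberField.exists_norm_perron_vonMangoldtIdeal_sub_le`, `PerronTruncatedDedekind.lean`);
3. horizontal sides `≪ M_K x/T₀`: the local partial fraction
   `ζ₁_K'/ζ₁_K = ∑_ρ m(ρ)/(s−ρ) + O(M_K)` (`norm_logDeriv_dedekindZeta₁_sub_sum_le`,
   `DedekindZetaPartialFraction.lean`) and, for each of the `≤ 32 M_K` nearby zeros, the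
   Lagarias–Odlyzko device `‖∫ x^s/(s(s−ρ)) dσ‖ ≤ 8x^c/(|T|−1)` (`norm_integral_zeroSegment_le`,
   `ExplicitFormulaZeroSegment.lean`) — this, rather than Montgomery–Vaughan's good heights, keeps the
   estimate linear in `M_K`;
4. left side `σ = 1/4`: `|ζ₁_K'/ζ₁_K| ≤ 77888 M_K` under GRH
   (`norm_logDeriv_dedekindZeta₁_quarter_le_of_erh`), giving `≪ x^{1/4} M_K log x`;
5. under GRH `|x^ρ| = √x` and `∑_{|γ| ≤ T₀+1} m(ρ)/|ρ| ≤ 256 M_K(T₀+2)(1 + log(T₀+3))` by the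
   Jensen counts in unit windows (`sum_zeroOrder_div_norm_le_of_erh`).
With `T₀ = √x + 2` every term is `≪ √x log x (log|d_K| + n_K log x)`
(`exists_abs_chebyshevPsiIdeal_sub_le_halfInt`); the passage from half-integers to all `x ≥ 2` is
elementary (`ψ_K` is a step function, `ψ_K(x) ≤ n_K (x+1) log x` for small `x`).

## References

* J. C. Lagarias, A. M. Odlyzko, *Effective versions of the Chebotarev density theorem*, in:
  Algebraic Number Fields (Durham 1975), Academic Press 1977, 409–464, §§5–9, Thm. 9.1.
  [cite: LagariasOdlyzko1977, Thm. 9.1]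
* B. Winckler, *Théorème de Chebotarev effectif*, arXiv:1311.5715 (2013), Thm. 8.1. [cite: Winckler2013, Thm. 8.1]
* J.-P. Serre, *Quelques applications du théorème de densité de Chebotarev*, Publ. Math. IHÉS 54
  (1981), Thm. 4. [cite: Serre1981, Thm. 4]
* H. L. Montgomery, R. C. Vaughan, *Multiplicative Number Theory I*, CUP 2007, §12.1, Thm. 13.1.
  [cite: MontgomeryVaughan2007, Thm. 13.1]
-/

noncomputable section

open Complex Set MeasureTheory Filter Topology intervalIntegral Real Metric MeromorphicOn
open scoped NumberField Interval

namespace Literature.NumberTheory.LFunctions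

section Field

variable (K : Type*) [Field K] [NumberField K]

/-! ### The integrand `F(s) = (−ζ₁_K'/ζ₁_K(s) + 1/(s−1)) · x^s/s` -/

/-- Continuity of the integrand at a point where `ζ₁_K(s) ≠ 0`, `s ≠ 0, 1`. [folklore] -/
theorem continuousAt_dedekindVonKochIntegrand {x : ℝ} (hx : 0 < x) {s : ℂ}
    (hζ : dedekindZeta₁ K s ≠ 0) (hs0 : s ≠ 0) (hs1 : s ≠ 1) :
    ContinuousAt (fun s : ℂ ↦ (-(deriv (dedekindZeta₁ K) s / dedekindZeta₁ K s) + (s - 1)⁻¹) *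
      ((x : ℂ) ^ s / s)) s := by
  have h1 : ContinuousAt (deriv (dedekindZeta₁ K)) s :=
    ((dedekindZeta₁_differentiable K).analyticAt s).deriv.continuousAt
  have h2 : ContinuousAt (dedekindZeta₁ K) s := ((dedekindZeta₁_differentiable K) s).continuousAt
  have h3 : ContinuousAt (fun s : ℂ ↦ (x : ℂ) ^ s) s :=
    continuousAt_const_cpow (ofReal_ne_zero.2 hx.ne')
  have h4 : ContinuousAt (fun s : ℂ ↦ (s - 1)⁻¹) s :=
    (continuousAt_id.sub continuousAt_const).inv₀ (sub_ne_zero.2 hs1)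
  exact ((h1.div h2 hζ).neg.add h4).mul (h3.div continuousAt_id hs0)

/-- On `Re s > 1`: `−ζ₁_K'/ζ₁_K(s) + 1/(s−1) = ∑ Λ_K(n) n^{-s}` (`ζ₁_K = (s−1)ζ_K` there, and
`−ζ_K'/ζ_K = L(Λ_K, ·)`, Landau 1903 §11). [cite: LandauMathAnn1903, §11 p. 668] -/
theorem neg_logDeriv_dedekindZeta₁_add_inv_eq {s : ℂ} (hs : 1 < s.re) :
    -(deriv (dedekindZeta₁ K) s / dedekindZeta₁ K s) + (s - 1)⁻¹ =
      LSeries (fun n ↦ (NumberField.vonMangoldtIdeal K n : ℂ)) s := by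
  have hev : dedekindZeta₁ K =ᶠ[𝓝 s] fun w ↦ (w - 1) * _root_.NumberField.dedekindZeta K w := by
    have hopen : IsOpen {w : ℂ | 1 < w.re} := isOpen_lt continuous_const Complex.continuous_re
    filter_upwards [hopen.mem_nhds hs] with w hw
    exact dedekindZeta₁_apply_eq_mul hw
  rw [hev.deriv_eq, hev.eq_of_nhds, NumberField.logDeriv_sub_one_mul_dedekindZeta K hs]
  ring

/-- On the line `Re s = c > 1` the integrand is `L(Λ_K, s) x^s/s`. [folklore] -/
theorem dedekindVonKochIntegrand_eq_of_one_lt (x : ℝ) {c : ℝ} (hc : 1 < c) (t : ℝ) :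
    (fun s : ℂ ↦ (-(deriv (dedekindZeta₁ K) s / dedekindZeta₁ K s) + (s - 1)⁻¹) * ((x : ℂ) ^ s / s))
        (c + t * I) =
      LSeries (fun n ↦ (NumberField.vonMangoldtIdeal K n : ℂ)) (c + t * I) *
        ((x : ℂ) ^ ((c : ℂ) + t * I) / ((c : ℂ) + t * I)) := by
  have hre : 1 < ((c : ℂ) + t * I).re := by simp; exact hc
  simp only []
  rw [neg_logDeriv_dedekindZeta₁_add_inv_eq K hre]

/-! ### The residue identity on the rectangle `[a, b] × [lo, hi]` -/

/-- **The explicit formula on a rectangle for `ζ_K`** (Montgomery–Vaughan §12.1 / Lagarias–Odlyzko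
§7, restricted to `Re s ≥ a > 0`). For `x > 0`, `0 < a < 1 < b`, `lo < 0 < hi`, and `ζ₁_K ≠ 0` on
the boundary of `R = [a, b] × [lo, hi]`,
`∮_{∂R} (−ζ₁_K'/ζ₁_K(s) + 1/(s−1)) x^s/s ds = 2πi (x − ∑_{ρ ∈ R°, ζ_K(ρ) = 0} m(ρ) x^ρ/ρ)`
(four-term boundary convention of `Literature.Analysis.Complex.rectBoundaryIntegral`).
[cite: LagariasOdlyzko1977, §7] -/
theorem rectBoundaryIntegral_dedekindVonKoch_eq {x a b lo hi : ℝ} (hx : 0 < x) (ha0 : 0 < a)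
    (ha1 : a < 1) (hb : 1 < b) (hlo : lo < 0) (hhi : 0 < hi)
    (h_bot : ∀ σ ∈ Icc a b, dedekindZeta₁ K (σ + lo * I) ≠ 0)
    (h_top : ∀ σ ∈ Icc a b, dedekindZeta₁ K (σ + hi * I) ≠ 0)
    (h_left : ∀ t ∈ Icc lo hi, dedekindZeta₁ K (a + t * I) ≠ 0)
    (h_right : ∀ t ∈ Icc lo hi, dedekindZeta₁ K (b + t * I) ≠ 0) :
    Literature.Analysis.Complex.rectBoundaryIntegral
        (fun s : ℂ ↦ (-(deriv (dedekindZeta₁ K) s / dedekindZeta₁ K s) + (s - 1)⁻¹) *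
          ((x : ℂ) ^ s / s)) a b lo hi =
      2 * π * I * ((x : ℂ) - ∑ᶠ ρ ∈ {ρ : ℂ | dedekindZeta₁ K ρ = 0 ∧ ρ ∈ Ioo a b ×ℂ Ioo lo hi},
        ((meromorphicOrderAt (dedekindZeta₁ K) ρ).untop₀ : ℂ) * ((x : ℂ) ^ ρ / ρ)) := by
  classical
  set f := dedekindZeta₁ K with hf
  have hfd : Differentiable ℂ f := dedekindZeta₁_differentiable K
  have hab : a < b := ha1.trans hb
  have hcd : lo < hi := hlo.trans hhi
  set g : ℂ → ℂ := fun s ↦ (x : ℂ) ^ s / s with hg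
  have hK0 : ∀ s ∈ Icc a b ×ℂ Icc lo hi, s ≠ 0 := by
    intro s hs h0
    have h1 : a ≤ s.re := (mem_reProdIm.1 hs).1.1
    rw [h0, Complex.zero_re] at h1
    linarith
  have hgd : ∀ s : ℂ, s ≠ 0 → DifferentiableAt ℂ g s := fun s hs ↦
    (differentiableAt_id.const_cpow (Or.inl (ofReal_ne_zero.2 hx.ne'))).div differentiableAt_id hs
  have hgD : DifferentiableOn ℂ g {(0 : ℂ)}ᶜ := fun s hs ↦ (hgd s hs).differentiableWithinAt
  have hgA' : AnalyticOnNhd ℂ g {(0 : ℂ)}ᶜ := hgD.analyticOnNhd isOpen_compl_singleton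
  have hgA : AnalyticOnNhd ℂ g (Icc a b ×ℂ Icc lo hi) := hgA'.mono fun s hs ↦ hK0 s hs
  have hfA : AnalyticOnNhd ℂ f (Icc a b ×ℂ Icc lo hi) := fun s _ ↦ hfd.analyticAt s
  -- (1) the weighted argument principle for `ζ₁_K` and `g`
  have h1 := Literature.Analysis.Complex.integral_boundary_rect_logDeriv_mul hab hcd hfA hgA h_bot
    h_top h_left h_right
  have h1' : Literature.Analysis.Complex.rectBoundaryIntegral (fun z ↦ deriv f z / f z * g z) a b lo hi =
      2 * π * I * ∑ᶠ ρ ∈ {ρ : ℂ | f ρ = 0 ∧ ρ ∈ Ioo a b ×ℂ Ioo lo hi},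
        ((meromorphicOrderAt f ρ).untop₀ : ℂ) * g ρ := by
    rw [Literature.Analysis.Complex.rectBoundaryIntegral_def]
    exact h1
  -- (2) Cauchy's formula for `g(s)/(s - 1)`: residue `g(1) = x`
  have h2 : Literature.Analysis.Complex.rectBoundaryIntegral (fun z ↦ (1 : ℂ) * (g z / (z - 1)))
      a b lo hi = 2 * π * I * 1 * g 1 :=
    Literature.Analysis.Complex.rectBoundaryIntegral_const_mul_div_sub (g := g) 1 1
      (by simpa using ha1) (by simpa using hb) (by simpa using hlo) (by simpa using hhi)
      hgA.differentiableOn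
  -- (3) continuity of the two pieces on the boundary
  have hne1_of_im : ∀ {s : ℂ}, s.im ≠ 0 → s ≠ 1 := fun h h1 ↦ by
    apply h; rw [h1]; simp
  have hne1_of_re : ∀ {s : ℂ}, s.re ≠ 1 → s ≠ 1 := fun h h1 ↦ by
    apply h; rw [h1]; simp
  have hcF₁ : ∀ s : ℂ, f s ≠ 0 → s ≠ 0 →
      ContinuousAt (fun z ↦ (-1 : ℂ) * (deriv f z / f z * g z)) s := by
    intro s hζ hs0
    have ha' : ContinuousAt (deriv f) s := (hfd.analyticAt s).deriv.continuousAt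
    have hb' : ContinuousAt f s := (hfd s).continuousAt
    exact continuousAt_const.mul ((ha'.div hb' hζ).mul (hgd s hs0).continuousAt)
  have hcF₂ : ∀ s : ℂ, s ≠ 0 → s ≠ 1 →
      ContinuousAt (fun z ↦ (1 : ℂ) * (g z / (z - 1))) s := by
    intro s hs0 hs1
    exact continuousAt_const.mul (((hgd s hs0).continuousAt).div
      (continuousAt_id.sub continuousAt_const) (sub_ne_zero.2 hs1))
  have h0_bot : ∀ σ ∈ Icc a b, ((σ : ℂ) + lo * I) ≠ 0 := fun σ hσ ↦
    hK0 _ (by simpa [mem_reProdIm] using ⟨hσ, hcd.le⟩)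
  have h0_top : ∀ σ ∈ Icc a b, ((σ : ℂ) + hi * I) ≠ 0 := fun σ hσ ↦
    hK0 _ (by simpa [mem_reProdIm] using ⟨hσ, hcd.le⟩)
  have h0_left : ∀ t ∈ Icc lo hi, ((a : ℂ) + t * I) ≠ 0 := fun t ht ↦
    hK0 _ (by simpa [mem_reProdIm] using ⟨hab.le, ht⟩)
  have h0_right : ∀ t ∈ Icc lo hi, ((b : ℂ) + t * I) ≠ 0 := fun t ht ↦
    hK0 _ (by simpa [mem_reProdIm] using ⟨hab.le, ht⟩)
  have h1_bot : ∀ σ : ℝ, ((σ : ℂ) + lo * I) ≠ 1 := fun σ ↦ hne1_of_im (by simp; exact hlo.ne)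
  have h1_top : ∀ σ : ℝ, ((σ : ℂ) + hi * I) ≠ 1 := fun σ ↦ hne1_of_im (by simp; exact hhi.ne')
  have h1_left : ∀ t : ℝ, ((a : ℂ) + t * I) ≠ 1 := fun t ↦ hne1_of_re (by simp; exact ha1.ne)
  have h1_right : ∀ t : ℝ, ((b : ℂ) + t * I) ≠ 1 := fun t ↦ hne1_of_re (by simp; exact hb.ne')
  -- (4) split the integrand and add up
  have hsplit : (fun s : ℂ ↦ (-(deriv f s / f s) + (s - 1)⁻¹) * ((x : ℂ) ^ s / s)) =
      fun s ↦ (-1 : ℂ) * (deriv f s / f s * g s) + (1 : ℂ) * (g s / (s - 1)) := by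
    funext s; simp only [hg]; ring
  rw [hsplit, Literature.Analysis.Complex.rectBoundaryIntegral_add hab.le hcd.le
      (fun σ hσ ↦ hcF₁ _ (h_bot σ hσ) (h0_bot σ hσ)) (fun σ hσ ↦ hcF₁ _ (h_top σ hσ) (h0_top σ hσ))
      (fun t ht ↦ hcF₁ _ (h_left t ht) (h0_left t ht))
      (fun t ht ↦ hcF₁ _ (h_right t ht) (h0_right t ht))
      (fun σ hσ ↦ hcF₂ _ (h0_bot σ hσ) (h1_bot σ)) (fun σ hσ ↦ hcF₂ _ (h0_top σ hσ) (h1_top σ))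
      (fun t ht ↦ hcF₂ _ (h0_left t ht) (h1_left t))
      (fun t ht ↦ hcF₂ _ (h0_right t ht) (h1_right t)),
    Literature.Analysis.Complex.rectBoundaryIntegral_const_mul, h1', h2]
  simp only [hg, Complex.cpow_one, div_one]
  ring

/-! ### Heights avoiding the ordinates of the zeros -/

/-- Every interval `[T₀, T₀ + 1]` contains a height `T` which is the ordinate of no zero of `ζ₁_K`
with `0 < Re ρ < 3` (there are only finitely many zeros in `[0, 3] × [T₀, T₀ + 1]`). [folklore] -/
theorem exists_height_not_ordinate (T₀ : ℝ) :
    ∃ T ∈ Icc T₀ (T₀ + 1), ∀ ρ : ℂ, dedekindZeta₁ K ρ = 0 → 0 < ρ.re → ρ.re < 3 → ρ.im ≠ T := by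
  classical
  set f := dedekindZeta₁ K with hf
  have hfA : AnalyticOnNhd ℂ f (Icc (0 : ℝ) 3 ×ℂ Icc (T₀ - 1) (T₀ + 2)) := fun s _ ↦
    (dedekindZeta₁_differentiable K).analyticAt s
  have hcorner : ((3 : ℝ) : ℂ) + T₀ * I ∈ Icc (0 : ℝ) 3 ×ℂ Icc (T₀ - 1) (T₀ + 2) := by
    have hre : (((3 : ℝ) : ℂ) + T₀ * I).re = 3 := by simp
    have him : (((3 : ℝ) : ℂ) + T₀ * I).im = T₀ := by simp
    rw [mem_reProdIm, hre, him, mem_Icc, mem_Icc]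
    exact ⟨⟨by norm_num, le_rfl⟩, by linarith, by linarith⟩
  have hw : f (((3 : ℝ) : ℂ) + T₀ * I) ≠ 0 := dedekindZeta₁_ne_zero_of_one_le_re (by simp)
  have hfin := Literature.Analysis.Complex.finite_zeros_reProdIm (f := f) (by norm_num : (0 : ℝ) ≤ 3)
    (by linarith : T₀ - 1 ≤ T₀ + 2) hfA hcorner hw
  have hfinIm : (Complex.im '' {ρ : ℂ | f ρ = 0 ∧ ρ ∈ Ioo (0 : ℝ) 3 ×ℂ Ioo (T₀ - 1) (T₀ + 2)}).Finite :=
    hfin.image _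
  obtain ⟨T, hT, hTnot⟩ :=
    Set.Infinite.exists_notMem_finite (Icc_infinite (by linarith : T₀ < T₀ + 1)) hfinIm
  refine ⟨T, hT, fun ρ hρ h0 h3 hρT ↦ hTnot ⟨ρ, ⟨hρ, ?_⟩, hρT⟩⟩
  rw [mem_reProdIm]
  refine ⟨⟨h0, h3⟩, ?_, ?_⟩
  · rw [hρT]; linarith [hT.1]
  · rw [hρT]; linarith [hT.2]

/-! ### The horizontal sides -/

/-- **Horizontal sides, uniformly in `K`** (Lagarias–Odlyzko 1977, §7, estimate of `H*`; under GRH).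
Assume ERH for `K`; let `x ≥ 1`, `1 < c ≤ 2` with `x^c = e·x`, `|T| ≥ 3`, and suppose `T` is not
the ordinate of a zero (`ζ₁_K(1/2 + iT) ≠ 0`). Then
`‖∫_{1/4}^{c} F(σ + iT) dσ‖ ≤ 155778 e · M_K(T) · x/(|T| − 1)`, `F(s) = (−ζ₁_K'/ζ₁_K(s) + 1/(s−1)) x^s/s`:
write `ζ₁_K'/ζ₁_K = ∑_ρ m(ρ)/(s − ρ) + E`, `|E| ≤ 77760 M_K(T)` on the segment
(`norm_logDeriv_dedekindZeta₁_sub_sum_le`); the `E`-part is `≤ 2(77760 M_K + 1) e x/|T|`, and each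
of the `≤ 32 M_K(T)` zero terms is `≤ 8 e x/(|T| − 1)` (`norm_integral_zeroSegment_le`).
[cite: LagariasOdlyzko1977, §7] -/
theorem norm_dedekindVonKoch_horizontal_le (hERH : NumberField.ExtendedRiemannHypothesis K)
    {x c T : ℝ} (hx : 1 ≤ x) (hc1 : 1 < c) (hc2 : c ≤ 2) (hxc : x ^ c = Real.exp 1 * x)
    (hT : 3 ≤ |T|) (hz : dedekindZeta₁ K (1 / 2 + T * I) ≠ 0) :
    ‖∫ σ in (1 / 4 : ℝ)..c, (fun s : ℂ ↦ (-(deriv (dedekindZeta₁ K) s / dedekindZeta₁ K s) +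
        (s - 1)⁻¹) * ((x : ℂ) ^ s / s)) (σ + T * I)‖ ≤
      155778 * Real.exp 1 * discBound K T * x / (|T| - 1) := by
  classical
  set f := dedekindZeta₁ K with hf
  set D := divisor f (closedBall (2 + T * I) (31 / 16)) with hD
  set S := (D.finiteSupport (isCompact_closedBall _ _)).toFinset with hS
  set M := discBound K T with hM
  have hM1 : 1 ≤ M := one_le_discBound K T
  have hx0 : 0 < x := by linarith
  have h14c : (1 / 4 : ℝ) ≤ c := by linarith
  have hT0 : T ≠ 0 := by intro h; rw [h, abs_zero] at hT; linarith
  have hT1 : 0 < |T| - 1 := by linarith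
  have hTpos : 0 < |T| := by linarith
  set F : ℂ → ℂ := fun s ↦ (-(deriv f s / f s) + (s - 1)⁻¹) * ((x : ℂ) ^ s / s) with hF
  set k : ℂ → ℝ → ℂ := fun u σ ↦
    (x : ℂ) ^ ((σ : ℂ) + T * I) / (((σ : ℂ) + T * I) * ((σ : ℂ) + T * I - u)) with hk
  -- facts along the segment
  have hseg_ball : ∀ σ ∈ Icc (1 / 4 : ℝ) c, ((σ : ℂ) + T * I) ∈ closedBall (2 + (T : ℂ) * I) (7 / 4) :=
    fun σ hσ ↦ mem_closedBall_of_re_mem_Icc ⟨hσ.1, hσ.2.trans hc2⟩ T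
  have hseg_ne : ∀ σ ∈ Icc (1 / 4 : ℝ) c, f ((σ : ℂ) + T * I) ≠ 0 := by
    intro σ hσ h0
    have hre : ((σ : ℂ) + T * I).re = σ := by simp
    have h12 := re_eq_one_half_of_erh hERH h0 (by rw [hre]; linarith [hσ.1])
    rw [hre] at h12
    apply hz
    have : (1 / 2 + T * I : ℂ) = (σ : ℂ) + T * I := by
      rw [h12]; push_cast; ring
    rw [this]; exact h0
  have hseg0 : ∀ σ : ℝ, ((σ : ℂ) + T * I) ≠ 0 := fun σ h ↦ hT0 (by simpa using congrArg Complex.im h)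
  have hseg1 : ∀ σ : ℝ, ((σ : ℂ) + T * I) ≠ 1 := fun σ h ↦ hT0 (by simpa using congrArg Complex.im h)
  -- zeros in the disc: on the critical line, with ordinates `≠ T`, off the segment
  have hSre : ∀ u ∈ S, u.re = 1 / 2 := fun u hu ↦ re_eq_one_half_of_mem_support_of_erh hERH hu
  have hSim : ∀ u ∈ S, u.im ≠ T := by
    intro u hu huT
    obtain ⟨hfu, -⟩ := zero_of_mem_support_divisor_bigDisc hu
    apply hz
    have : (1 / 2 + T * I : ℂ) = u := by
      apply Complex.ext
      · simp [hSre u hu]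
      · simp [huT]
    rw [this]; exact hfu
  have hSne : ∀ u ∈ S, ∀ σ ∈ Icc (1 / 4 : ℝ) c, ((σ : ℂ) + T * I) ≠ u := by
    intro u hu σ hσ h
    obtain ⟨hfu, -⟩ := zero_of_mem_support_divisor_bigDisc hu
    exact hseg_ne σ hσ (by rw [h]; exact hfu)
  have hD0 : ∀ u, 0 ≤ D u := fun u ↦ divisor_dedekindZeta₁_nonneg K _ _ u
  -- integrability along the segment
  have hFc : ∀ σ ∈ Icc (1 / 4 : ℝ) c, ContinuousAt F ((σ : ℂ) + T * I) := fun σ hσ ↦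
    continuousAt_dedekindVonKochIntegrand K hx0 (hseg_ne σ hσ) (hseg0 σ) (hseg1 σ)
  have hFi : IntervalIntegrable (fun σ : ℝ ↦ F ((σ : ℂ) + T * I)) volume (1 / 4) c :=
    Literature.Analysis.Complex.intervalIntegrable_of_continuousAt_horizontal T h14c hFc
  have hkc : ∀ u ∈ S, ∀ σ ∈ Icc (1 / 4 : ℝ) c,
      ContinuousAt (fun s : ℂ ↦ (x : ℂ) ^ s / (s * (s - u))) ((σ : ℂ) + T * I) := by
    intro u hu σ hσ
    exact (continuousAt_const_cpow (ofReal_ne_zero.2 hx0.ne')).div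
      (continuousAt_id.mul (continuousAt_id.sub continuousAt_const))
      (mul_ne_zero (hseg0 σ) (sub_ne_zero.2 (hSne u hu σ hσ)))
  have hki : ∀ u ∈ S, IntervalIntegrable (k u) volume (1 / 4) c := fun u hu ↦
    Literature.Analysis.Complex.intervalIntegrable_of_continuousAt_horizontal
      (F := fun s : ℂ ↦ (x : ℂ) ^ s / (s * (s - u))) T h14c (hkc u hu)
  have hsum_i : IntervalIntegrable (fun σ ↦ ∑ u ∈ S, (D u : ℂ) * k u σ) volume (1 / 4) c := by
    have h := IntervalIntegrable.sum S (f := fun u σ ↦ (D u : ℂ) * k u σ)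
      (fun u hu ↦ (hki u hu).const_mul _)
    rwa [Finset.sum_fn] at h
  -- pointwise bound for the `E`-part
  have hbound : ∀ σ ∈ Ι (1 / 4 : ℝ) c,
      ‖F ((σ : ℂ) + T * I) + ∑ u ∈ S, (D u : ℂ) * k u σ‖ ≤ (77760 * M + 1) * (Real.exp 1 * x / |T|) := by
    intro σ hσ
    rw [uIoc_of_le h14c] at hσ
    have hσ' : σ ∈ Icc (1 / 4 : ℝ) c := ⟨hσ.1.le, hσ.2⟩
    set s : ℂ := (σ : ℂ) + T * I with hs
    have hE := norm_logDeriv_dedekindZeta₁_sub_sum_le K T (hseg_ball σ hσ') (hseg_ne σ hσ')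
    have hs0 : s ≠ 0 := hseg0 σ
    have hid : F s + ∑ u ∈ S, (D u : ℂ) * k u σ =
        (-(logDeriv f s - ∑ u ∈ S, (D u : ℂ) / (s - u)) + (s - 1)⁻¹) * ((x : ℂ) ^ s / s) := by
      have hterm : ∀ u ∈ S, (D u : ℂ) * k u σ = (D u : ℂ) / (s - u) * ((x : ℂ) ^ s / s) := by
        intro u hu
        have hsu : s - u ≠ 0 := sub_ne_zero.2 (hSne u hu σ hσ')
        simp only [hk, ← hs]
        field_simp
      rw [Finset.sum_congr rfl hterm, ← Finset.sum_mul, logDeriv_apply]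
      simp only [hF]
      ring
    rw [hid, norm_mul]
    have h1 : ‖-(logDeriv f s - ∑ u ∈ S, (D u : ℂ) / (s - u)) + (s - 1)⁻¹‖ ≤ 77760 * M + 1 := by
      refine (norm_add_le _ _).trans (add_le_add ?_ ?_)
      · rw [norm_neg]; exact hE
      · rw [norm_inv]
        refine inv_le_one_of_one_le₀ ?_
        calc (1 : ℝ) ≤ |T| := by linarith
          _ = |(s - 1).im| := by simp [hs]
          _ ≤ ‖s - 1‖ := abs_im_le_norm _
    have h2 : ‖(x : ℂ) ^ s / s‖ ≤ Real.exp 1 * x / |T| := by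
      have h := norm_cpow_div_le_horizontal hx0 σ hT0
      refine h.trans ?_
      have hxσ : x ^ σ ≤ Real.exp 1 * x := by
        rw [← hxc]; exact Real.rpow_le_rpow_of_exponent_le hx hσ.2
      exact div_le_div_of_nonneg_right hxσ (abs_nonneg _)
    exact mul_le_mul h1 h2 (norm_nonneg _) (by positivity)
  -- the `E`-part integrated
  have hI1 : ‖∫ σ in (1 / 4 : ℝ)..c, (F ((σ : ℂ) + T * I) + ∑ u ∈ S, (D u : ℂ) * k u σ)‖ ≤
      (77760 * M + 1) * (Real.exp 1 * x / |T|) * 2 := by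
    refine (norm_integral_le_of_norm_le_const hbound).trans ?_
    rw [abs_of_nonneg (show (0 : ℝ) ≤ c - 1 / 4 by linarith)]
    exact mul_le_mul_of_nonneg_left (by linarith) (by positivity)
  -- each zero term
  have hI2 : ∀ u ∈ S, ‖∫ σ in (1 / 4 : ℝ)..c, k u σ‖ ≤ 8 * x ^ c / (|T| - 1) := fun u hu ↦
    norm_integral_zeroSegment_le hx hc1 hc2 (by linarith) (hSre u hu) (hSim u hu)
  -- linearity of the integral
  have hlin : (∫ σ in (1 / 4 : ℝ)..c, (F ((σ : ℂ) + T * I) + ∑ u ∈ S, (D u : ℂ) * k u σ)) =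
      (∫ σ in (1 / 4 : ℝ)..c, F ((σ : ℂ) + T * I)) +
        ∑ u ∈ S, (D u : ℂ) * ∫ σ in (1 / 4 : ℝ)..c, k u σ := by
    rw [intervalIntegral.integral_add hFi hsum_i,
      intervalIntegral.integral_finsetSum (fun u hu ↦ (hki u hu).const_mul _)]
    simp only [intervalIntegral.integral_const_mul]
  have hsumD : ∑ u ∈ S, (D u : ℝ) ≤ 32 * M := sum_divisor_dedekindZeta₁_bigDisc_le K T
  -- numerical bookkeeping
  set Q : ℝ := Real.exp 1 * x / (|T| - 1) with hQ
  have hQ0 : 0 ≤ Q := by positivity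
  have hQ1 : Real.exp 1 * x / |T| ≤ Q :=
    div_le_div_of_nonneg_left (by positivity) hT1 (by linarith)
  have hxcQ : 8 * x ^ c / (|T| - 1) = 8 * Q := by rw [hxc, hQ]; ring
  calc ‖∫ σ in (1 / 4 : ℝ)..c, F ((σ : ℂ) + T * I)‖
      = ‖(∫ σ in (1 / 4 : ℝ)..c, (F ((σ : ℂ) + T * I) + ∑ u ∈ S, (D u : ℂ) * k u σ)) -
          ∑ u ∈ S, (D u : ℂ) * ∫ σ in (1 / 4 : ℝ)..c, k u σ‖ := by rw [hlin, add_sub_cancel_right]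
    _ ≤ ‖∫ σ in (1 / 4 : ℝ)..c, (F ((σ : ℂ) + T * I) + ∑ u ∈ S, (D u : ℂ) * k u σ)‖ +
          ‖∑ u ∈ S, (D u : ℂ) * ∫ σ in (1 / 4 : ℝ)..c, k u σ‖ := norm_sub_le _ _
    _ ≤ (77760 * M + 1) * (Real.exp 1 * x / |T|) * 2 +
          ∑ u ∈ S, (D u : ℝ) * (8 * x ^ c / (|T| - 1)) := by
        refine add_le_add hI1 ((norm_sum_le _ _).trans (Finset.sum_le_sum fun u hu ↦ ?_))
        rw [norm_mul, Complex.norm_intCast, abs_of_nonneg (by exact_mod_cast hD0 u)]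
        exact mul_le_mul_of_nonneg_left (hI2 u hu) (by exact_mod_cast hD0 u)
    _ = (77760 * M + 1) * (Real.exp 1 * x / |T|) * 2 + (∑ u ∈ S, (D u : ℝ)) * (8 * Q) := by
        rw [Finset.sum_mul, hxcQ]
    _ ≤ (77761 * M) * Q * 2 + (32 * M) * (8 * Q) := by
        have h1 : (77760 * M + 1) * (Real.exp 1 * x / |T|) * 2 ≤ (77761 * M) * Q * 2 := by
          have : 77760 * M + 1 ≤ 77761 * M := by linarith
          have h0 : 0 ≤ 77760 * M + 1 := by positivity
          nlinarith
        have h2 : (∑ u ∈ S, (D u : ℝ)) * (8 * Q) ≤ (32 * M) * (8 * Q) :=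
          mul_le_mul_of_nonneg_right hsumD (by positivity)
        exact add_le_add h1 h2
    _ = 155778 * Real.exp 1 * M * x / (|T| - 1) := by rw [hQ]; ring

/-! ### Monotonicity of the disc bound -/

/-- `M_K(t) ≤ M_K(t')` for `|t| ≤ |t'|`. [folklore] -/
theorem discBound_mono {t t' : ℝ} (h : |t| ≤ |t'|) : discBound K t ≤ discBound K t' := by
  unfold discBound
  have h1 : Real.log (|t| + 7) ≤ Real.log (|t'| + 7) :=
    Real.log_le_log (by linarith [abs_nonneg t]) (by linarith)
  have h2 : (0 : ℝ) ≤ Module.finrank ℚ K + 1 := by positivity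
  nlinarith

/-! ### The left side `σ = 1/4` -/

/-- **The left side, uniformly in `K`.** Under ERH for `K`, for `x ≥ 1`, `A ≥ 1` and
`[lo, hi] ⊆ [−A, A]`: `‖∫_{lo}^{hi} F(1/4 + it) dt‖ ≤ x^{1/4} · 77890 M_K(A) · 10 log(A + 1)`
(`|ζ₁_K'/ζ₁_K(1/4+it)| ≤ 77888 M_K(t)`, `|1/(s−1)| ≤ 4/3`, `‖x^s‖ = x^{1/4}`, `1/‖s‖ ≤ 5/(|t|+1)`).
[cite: LagariasOdlyzko1977, §7] -/
theorem norm_dedekindVonKoch_left_le (hERH : NumberField.ExtendedRiemannHypothesis K)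
    {x lo hi A : ℝ} (hx : 1 ≤ x) (hA : 1 ≤ A) (hlo : -A ≤ lo) (hlohi : lo ≤ hi) (hhi : hi ≤ A) :
    ‖∫ t in lo..hi, (fun s : ℂ ↦ (-(deriv (dedekindZeta₁ K) s / dedekindZeta₁ K s) + (s - 1)⁻¹) *
        ((x : ℂ) ^ s / s)) ((1 / 4 : ℝ) + t * I)‖ ≤
      x ^ (1 / 4 : ℝ) * (77890 * discBound K A) * (10 * Real.log (A + 1)) := by
  have hx0 : 0 < x := one_pos.trans_le hx
  have e14 : ((1 / 4 : ℝ) : ℂ) = 1 / 4 := by push_cast; ring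
  set M : ℝ := 77890 * discBound K A with hM
  have hMA1 : 1 ≤ discBound K A := one_le_discBound K A
  have hM0 : 0 ≤ M := by positivity
  set C : ℝ := x ^ (1 / 4 : ℝ) * M with hC
  have hC0 : 0 ≤ C := by positivity
  have hbound : ∀ᵐ t : ℝ, t ∈ Ioc lo hi →
      ‖(fun s : ℂ ↦ (-(deriv (dedekindZeta₁ K) s / dedekindZeta₁ K s) + (s - 1)⁻¹) *
        ((x : ℂ) ^ s / s)) ((1 / 4 : ℝ) + t * I)‖ ≤ C * (5 * (|t| + 1)⁻¹) := by
    refine Eventually.of_forall fun t ht ↦ ?_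
    rw [e14]
    set s : ℂ := 1 / 4 + t * I with hs
    have hsre : s.re = 1 / 4 := by simp [hs]
    have hns0 : 0 < ‖s‖ := by
      refine norm_pos_iff.2 fun h0 ↦ ?_
      have := congrArg Complex.re h0; rw [hsre] at this; simp at this
    -- the log-derivative factor
    have htA : |t| ≤ |A| := by
      rw [abs_of_nonneg (by linarith : (0 : ℝ) ≤ A), abs_le]
      constructor <;> linarith [ht.1, ht.2]
    have hld : ‖logDeriv (dedekindZeta₁ K) s‖ ≤ 77888 * discBound K A :=
      (norm_logDeriv_dedekindZeta₁_quarter_le_of_erh K hERH t).trans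
        (mul_le_mul_of_nonneg_left (discBound_mono K htA) (by norm_num))
    have hinv1 : ‖(s - 1)⁻¹‖ ≤ 2 := by
      rw [norm_inv]
      have h34 : (3 / 4 : ℝ) ≤ ‖s - 1‖ := by
        calc (3 / 4 : ℝ) = |(s - 1).re| := by rw [sub_re, hsre]; norm_num
          _ ≤ ‖s - 1‖ := abs_re_le_norm _
      calc ‖s - 1‖⁻¹ ≤ (3 / 4 : ℝ)⁻¹ := inv_anti₀ (by norm_num) h34
        _ ≤ 2 := by norm_num
    have hA' : ‖-(deriv (dedekindZeta₁ K) s / dedekindZeta₁ K s) + (s - 1)⁻¹‖ ≤ M := by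
      refine (norm_add_le _ _).trans ?_
      rw [norm_neg, ← logDeriv_apply]
      have : (2 : ℝ) ≤ 2 * discBound K A := by linarith
      linarith
    -- the kernel factor
    have hxs : ‖(x : ℂ) ^ s‖ = x ^ (1 / 4 : ℝ) := by
      rw [Complex.norm_cpow_eq_rpow_re_of_pos hx0, hsre]
    have hinv : ‖s‖⁻¹ ≤ 5 * (|t| + 1)⁻¹ := by
      have h5 := abs_add_one_le_five_mul_norm t
      rw [← hs] at h5
      have hpos : 0 < |t| + 1 := by positivity
      rw [inv_le_comm₀ hns0 (by positivity), mul_inv, inv_inv]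
      calc (5 : ℝ)⁻¹ * (|t| + 1) ≤ 5⁻¹ * (5 * ‖s‖) := by gcongr
        _ = ‖s‖ := by ring
    rw [norm_mul, norm_div ((x : ℂ) ^ s) s, hxs]
    calc ‖-(deriv (dedekindZeta₁ K) s / dedekindZeta₁ K s) + (s - 1)⁻¹‖ * (x ^ (1 / 4 : ℝ) / ‖s‖)
        = ‖-(deriv (dedekindZeta₁ K) s / dedekindZeta₁ K s) + (s - 1)⁻¹‖ * x ^ (1 / 4 : ℝ) * ‖s‖⁻¹ := by
          rw [div_eq_mul_inv]; ring
      _ ≤ M * x ^ (1 / 4 : ℝ) * (5 * (|t| + 1)⁻¹) :=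
          mul_le_mul (mul_le_mul_of_nonneg_right hA' (by positivity)) hinv (by positivity)
            (mul_nonneg hM0 (by positivity))
      _ = C * (5 * (|t| + 1)⁻¹) := by rw [hC]; ring
  have hcont : Continuous fun t : ℝ ↦ C * (5 * (|t| + 1)⁻¹) :=
    continuous_const.mul (continuous_const.mul
      ((continuous_abs.add continuous_const).inv₀ fun t ↦ (by positivity : (0 : ℝ) < |t| + 1).ne'))
  refine (norm_integral_le_of_norm_le hlohi hbound (hcont.intervalIntegrable _ _)).trans ?_
  rw [intervalIntegral.integral_const_mul, intervalIntegral.integral_const_mul]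
  have hI := integral_inv_abs_add_one_le (A := A) (by linarith) hlo hlohi hhi
  calc C * (5 * ∫ t in lo..hi, (|t| + 1)⁻¹) ≤ C * (5 * (2 * Real.log (A + 1))) := by gcongr
    _ = x ^ (1 / 4 : ℝ) * (77890 * discBound K A) * (10 * Real.log (A + 1)) := by rw [hC, hM]; ring

/-! ### The sum over the zeros, under ERH -/

/-- A point on the critical line lies in the disc `|s − (2 + ik)| ≤ 31/16` about the nearest integer
height `k = round(Im ρ)` (`(3/2)² + (1/2)² = 5/2 ≤ (31/16)²`). [folklore] -/
theorem mem_closedBall_round_of_re_eq_half {ρ : ℂ} (hρ : ρ.re = 1 / 2) :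
    ρ ∈ closedBall (2 + ((round ρ.im : ℤ) : ℝ) * I) (31 / 16) := by
  rw [mem_closedBall, dist_eq_norm]
  set z : ℂ := ρ - (2 + ((round ρ.im : ℤ) : ℝ) * I) with hz
  have hzre : z.re = -(3 / 2) := by
    simp only [hz, sub_re, add_re, re_ofNat, mul_re, ofReal_re, I_re, mul_zero, ofReal_im, I_im,
      mul_one, sub_self, add_zero, hρ]
    norm_num
  have hzim : z.im = ρ.im - round ρ.im := by simp [hz]
  have him : |z.im| ≤ 1 / 2 := by rw [hzim]; exact abs_sub_round ρ.im
  have hsq : ‖z‖ ^ 2 ≤ (31 / 16 : ℝ) ^ 2 := by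
    rw [Complex.sq_norm, Complex.normSq_apply, hzre]
    have h1 : z.im * z.im ≤ 1 / 4 := by
      have := abs_le.mp him
      nlinarith
    nlinarith
  nlinarith [norm_nonneg z, hsq]

/-- For a finite set of points and an integer height `k`, the divisor mass of `ζ₁_K` on the disc
`|s − (2 + ik)| ≤ 31/16` carried by the set is at most `32 M_K(k)` (the divisor is `≥ 0` and its
total mass is `≤ 32 M_K(k)`, `sum_divisor_dedekindZeta₁_bigDisc_le`). [folklore] -/
theorem sum_divisor_le_of_finset (k : ℝ) (G : Finset ℂ) :
    ∑ ρ ∈ G, (divisor (dedekindZeta₁ K) (closedBall (2 + (k : ℂ) * I) (31 / 16)) ρ : ℝ) ≤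
      32 * discBound K k := by
  classical
  set D := divisor (dedekindZeta₁ K) (closedBall (2 + (k : ℂ) * I) (31 / 16)) with hD
  set S := (D.finiteSupport (isCompact_closedBall _ _)).toFinset with hS
  have hD0 : ∀ u, 0 ≤ D u := fun u ↦ divisor_dedekindZeta₁_nonneg K _ _ u
  have h1 : ∑ ρ ∈ G, (D ρ : ℝ) = ∑ ρ ∈ G.filter (fun ρ ↦ (D ρ : ℝ) ≠ 0), (D ρ : ℝ) :=
    (Finset.sum_filter_ne_zero G).symm
  have hsub : G.filter (fun ρ ↦ (D ρ : ℝ) ≠ 0) ⊆ S := by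
    intro ρ hρ
    rw [Finset.mem_filter] at hρ
    rw [hS, Set.Finite.mem_toFinset, Function.mem_support]
    exact_mod_cast hρ.2
  calc ∑ ρ ∈ G, (D ρ : ℝ) = ∑ ρ ∈ G.filter (fun ρ ↦ (D ρ : ℝ) ≠ 0), (D ρ : ℝ) := h1
    _ ≤ ∑ u ∈ S, (D u : ℝ) :=
        Finset.sum_le_sum_of_subset_of_nonneg hsub fun u _ _ ↦ by exact_mod_cast hD0 u
    _ ≤ 32 * discBound K k := sum_divisor_dedekindZeta₁_bigDisc_le K k

/-- **The zero sum under ERH, uniformly in `K`** (Lagarias–Odlyzko 1977, (9.?)–§9 GRH case;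
Montgomery–Vaughan (13.1) for `ζ`): assume ERH for `K`, `U ≥ 1`, and let `F` be a finite set of zeros
`ρ` of `ζ₁_K` with `Re ρ > 0` (hence `Re ρ = 1/2`) and `|Im ρ| ≤ U`. Then
`∑_{ρ ∈ F} m(ρ)/|ρ| ≤ 256 M_K(U + 1) (1 + log(U + 2))`: group the zeros by the nearest integer
height `k`; in each group `|ρ| ≥ (|k| + 1)/4` and the multiplicities add up to at most `32 M_K(k)`
(Jensen, `sum_divisor_dedekindZeta₁_bigDisc_le`), and `∑_{j ≤ U+1} 1/(j+1) ≤ 1 + log(U + 2)`.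
[cite: LagariasOdlyzko1977, Lemma 5.4] -/
theorem sum_zeroOrder_div_norm_le_of_erh (hERH : NumberField.ExtendedRiemannHypothesis K)
    {U : ℝ} (hU : 1 ≤ U) (F : Finset ℂ)
    (hF : ∀ ρ ∈ F, dedekindZeta₁ K ρ = 0 ∧ 0 < ρ.re ∧ |ρ.im| ≤ U) :
    ∑ ρ ∈ F, ((meromorphicOrderAt (dedekindZeta₁ K) ρ).untop₀ : ℝ) / ‖ρ‖ ≤
      256 * discBound K (U + 1) * (1 + Real.log (U + 2)) := by
  classical
  set f := dedekindZeta₁ K with hf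
  set M := discBound K (U + 1) with hM
  have hM0 : 0 ≤ M := discBound_nonneg K _
  -- window index `w ρ = round (Im ρ)` and its size `j ρ = |w ρ|`
  set w : ℂ → ℤ := fun ρ ↦ round ρ.im with hw
  set j : ℂ → ℕ := fun ρ ↦ (w ρ).natAbs with hj
  have hjw : ∀ ρ, (j ρ : ℝ) = |(w ρ : ℝ)| := by
    intro ρ
    simp only [hj]
    rw [Nat.cast_natAbs, Int.cast_abs]
  have hre : ∀ ρ ∈ F, ρ.re = 1 / 2 := fun ρ hρ ↦
    re_eq_one_half_of_erh hERH (hF ρ hρ).1 (hF ρ hρ).2.1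
  have hwγ : ∀ ρ : ℂ, |ρ.im - (w ρ : ℝ)| ≤ 1 / 2 := fun ρ ↦ abs_sub_round ρ.im
  have hjU : ∀ ρ ∈ F, (j ρ : ℝ) ≤ U + 1 / 2 := by
    intro ρ hρ
    rw [hjw]
    have h1 := hwγ ρ
    have h2 := (hF ρ hρ).2.2
    have h3 := abs_sub_abs_le_abs_sub (w ρ : ℝ) ρ.im
    rw [abs_sub_comm] at h3
    linarith
  -- the multiplicity is the divisor on the disc of the window
  have horder : ∀ ρ ∈ F, ((meromorphicOrderAt f ρ).untop₀ : ℝ) =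
      (divisor f (closedBall (2 + ((w ρ : ℝ) : ℂ) * I) (31 / 16)) ρ : ℝ) := by
    intro ρ hρ
    have hmem : ρ ∈ closedBall (2 + ((w ρ : ℝ) : ℂ) * I) (31 / 16) :=
      mem_closedBall_round_of_re_eq_half (hre ρ hρ)
    rw [divisor_apply (analyticOnNhd_dedekindZeta₁ K _).meromorphicOn hmem]
  -- `|ρ| ≥ (j ρ + 1)/4`
  have hnorm : ∀ ρ ∈ F, (j ρ : ℝ) + 1 ≤ 4 * ‖ρ‖ := by
    intro ρ hρ
    have h1 : (1 / 2 : ℝ) ≤ ‖ρ‖ := by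
      calc (1 / 2 : ℝ) = |ρ.re| := by rw [hre ρ hρ]; norm_num
        _ ≤ ‖ρ‖ := abs_re_le_norm ρ
    have h2 : |(w ρ : ℝ)| - 1 / 2 ≤ ‖ρ‖ := by
      have h3 := abs_sub_abs_le_abs_sub (w ρ : ℝ) ρ.im
      rw [abs_sub_comm] at h3
      have h4 := hwγ ρ
      have h5 : |ρ.im| ≤ ‖ρ‖ := abs_im_le_norm ρ
      linarith
    rw [hjw]
    rcases le_or_gt |(w ρ : ℝ)| 1 with h | h
    · linarith
    · linarith
  -- per zero: `m(ρ)/|ρ| ≤ (4/(j ρ + 1)) · D_{w ρ}(ρ)`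
  have hterm : ∀ ρ ∈ F, ((meromorphicOrderAt f ρ).untop₀ : ℝ) / ‖ρ‖ ≤
      4 / ((j ρ : ℝ) + 1) * (divisor f (closedBall (2 + ((w ρ : ℝ) : ℂ) * I) (31 / 16)) ρ : ℝ) := by
    intro ρ hρ
    rw [horder ρ hρ]
    set d : ℝ := (divisor f (closedBall (2 + ((w ρ : ℝ) : ℂ) * I) (31 / 16)) ρ : ℝ) with hd
    have hd0 : 0 ≤ d := by rw [hd]; exact_mod_cast divisor_dedekindZeta₁_nonneg K _ _ ρ
    have hj0 : (0 : ℝ) ≤ j ρ := Nat.cast_nonneg _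
    have hρ0 : 0 < ‖ρ‖ := by linarith [hnorm ρ hρ]
    have hinv : ‖ρ‖⁻¹ ≤ 4 / ((j ρ : ℝ) + 1) := by
      rw [inv_le_comm₀ hρ0 (by positivity), inv_div]
      linarith [hnorm ρ hρ]
    calc d / ‖ρ‖ = d * ‖ρ‖⁻¹ := div_eq_mul_inv _ _
      _ ≤ d * (4 / ((j ρ : ℝ) + 1)) := mul_le_mul_of_nonneg_left hinv hd0
      _ = 4 / ((j ρ : ℝ) + 1) * d := mul_comm _ _
  -- the windows
  set N₀ : ℕ := ⌈U⌉₊ with hN₀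
  have hN₀U' : (N₀ : ℝ) < U + 1 := Nat.ceil_lt_add_one (by linarith)
  have hmaps : ∀ ρ ∈ F, j ρ ∈ Finset.range (N₀ + 1) := by
    intro ρ hρ
    rw [Finset.mem_range, Nat.lt_add_one_iff]
    have h1 : (j ρ : ℝ) < N₀ + 1 := by
      have := Nat.le_ceil U; linarith [hjU ρ hρ]
    exact Nat.lt_add_one_iff.mp (by exact_mod_cast h1)
  have hwin : ∀ n ∈ Finset.range (N₀ + 1),
      ∑ ρ ∈ F.filter (fun ρ ↦ j ρ = n), ((meromorphicOrderAt f ρ).untop₀ : ℝ) / ‖ρ‖ ≤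
        4 / ((n : ℝ) + 1) * (64 * M) := by
    intro n _
    set G := F.filter (fun ρ ↦ j ρ = n) with hG
    have hGF : ∀ ρ ∈ G, ρ ∈ F ∧ j ρ = n := fun ρ hρ ↦ by simpa [hG] using hρ
    have h1 : ∑ ρ ∈ G, ((meromorphicOrderAt f ρ).untop₀ : ℝ) / ‖ρ‖ ≤
        ∑ ρ ∈ G, 4 / ((n : ℝ) + 1) *
          (divisor f (closedBall (2 + ((w ρ : ℝ) : ℂ) * I) (31 / 16)) ρ : ℝ) := by
      refine Finset.sum_le_sum fun ρ hρ ↦ ?_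
      obtain ⟨hρF, hρn⟩ := hGF ρ hρ
      have := hterm ρ hρF
      rwa [hρn] at this
    rw [← Finset.mul_sum] at h1
    refine h1.trans (mul_le_mul_of_nonneg_left ?_ (by positivity))
    rcases G.eq_empty_or_nonempty with hGe | ⟨ρ₀, hρ₀⟩
    · rw [hGe, Finset.sum_empty]; positivity
    obtain ⟨hρ₀F, hρ₀n⟩ := hGF ρ₀ hρ₀
    have hnU : (n : ℝ) ≤ U + 1 / 2 := by
      have := hjU ρ₀ hρ₀F; rw [hρ₀n] at this; exact this
    have hMn : discBound K (n : ℝ) ≤ M := discBound_mono K (by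
      rw [abs_of_nonneg (Nat.cast_nonneg n), abs_of_nonneg (by linarith)]; linarith)
    have hMn' : discBound K (-(n : ℝ)) ≤ M := discBound_mono K (by
      rw [abs_neg, abs_of_nonneg (Nat.cast_nonneg n), abs_of_nonneg (by linarith)]; linarith)
    rw [← Finset.sum_filter_add_sum_filter_not G (fun ρ ↦ w ρ = n)]
    have hA : ∑ ρ ∈ G.filter (fun ρ ↦ w ρ = n),
        (divisor f (closedBall (2 + ((w ρ : ℝ) : ℂ) * I) (31 / 16)) ρ : ℝ) ≤ 32 * M := by
      calc ∑ ρ ∈ G.filter (fun ρ ↦ w ρ = n),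
            (divisor f (closedBall (2 + ((w ρ : ℝ) : ℂ) * I) (31 / 16)) ρ : ℝ)
          = ∑ ρ ∈ G.filter (fun ρ ↦ w ρ = n),
            (divisor f (closedBall (2 + ((n : ℝ) : ℂ) * I) (31 / 16)) ρ : ℝ) := by
              refine Finset.sum_congr rfl fun ρ hρ ↦ ?_
              rw [Finset.mem_filter] at hρ
              have hc : (2 : ℂ) + ((w ρ : ℝ) : ℂ) * I = 2 + ((n : ℝ) : ℂ) * I := by simp [hρ.2]
              rw [hc]
        _ ≤ 32 * discBound K (n : ℝ) := sum_divisor_le_of_finset K (n : ℝ) _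
        _ ≤ 32 * M := by linarith
    have hB : ∑ ρ ∈ G.filter (fun ρ ↦ ¬ w ρ = n),
        (divisor f (closedBall (2 + ((w ρ : ℝ) : ℂ) * I) (31 / 16)) ρ : ℝ) ≤ 32 * M := by
      calc ∑ ρ ∈ G.filter (fun ρ ↦ ¬ w ρ = n),
            (divisor f (closedBall (2 + ((w ρ : ℝ) : ℂ) * I) (31 / 16)) ρ : ℝ)
          = ∑ ρ ∈ G.filter (fun ρ ↦ ¬ w ρ = n),
            (divisor f (closedBall (2 + ((-(n : ℝ) : ℝ) : ℂ) * I) (31 / 16)) ρ : ℝ) := by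
              refine Finset.sum_congr rfl fun ρ hρ ↦ ?_
              rw [Finset.mem_filter] at hρ
              obtain ⟨hρG, hρw⟩ := hρ
              have hjn : (w ρ).natAbs = n := (hGF ρ hρG).2
              have hneg : w ρ = -(n : ℤ) := by
                rcases Int.natAbs_eq (w ρ) with h | h
                · rw [hjn] at h; exact absurd h hρw
                · rw [hjn] at h; exact h
              have hc : (2 : ℂ) + ((w ρ : ℝ) : ℂ) * I = 2 + ((-(n : ℝ) : ℝ) : ℂ) * I := by
                simp [hneg]
              rw [hc]
        _ ≤ 32 * discBound K (-(n : ℝ)) := sum_divisor_le_of_finset K (-(n : ℝ)) _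
        _ ≤ 32 * M := by linarith
    linarith
  -- sum over the windows
  rw [← Finset.sum_fiberwise_of_maps_to hmaps]
  have hharm : ∑ n ∈ Finset.range (N₀ + 1), 1 / ((n : ℝ) + 1) ≤ 1 + Real.log (U + 2) := by
    have h := sum_Ico_one_div_le (N₀ + 1)
    have e : ∑ n ∈ Finset.range (N₀ + 1), 1 / ((n : ℝ) + 1) =
        ∑ n ∈ Finset.Ico 1 (N₀ + 1 + 1), (1 / (n : ℝ)) := by
      rw [Finset.sum_Ico_eq_sum_range]
      refine Finset.sum_congr (by simp) fun i _ ↦ ?_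
      push_cast; ring
    rw [e]
    refine h.trans ?_
    push_cast
    have : Real.log ((N₀ : ℝ) + 1) ≤ Real.log (U + 2) :=
      Real.log_le_log (by positivity) (by linarith)
    linarith
  have hharm0 : 0 ≤ ∑ n ∈ Finset.range (N₀ + 1), 1 / ((n : ℝ) + 1) :=
    Finset.sum_nonneg fun n _ ↦ by positivity
  calc ∑ n ∈ Finset.range (N₀ + 1), ∑ ρ ∈ F.filter (fun ρ ↦ j ρ = n),
        ((meromorphicOrderAt f ρ).untop₀ : ℝ) / ‖ρ‖
      ≤ ∑ n ∈ Finset.range (N₀ + 1), 4 / ((n : ℝ) + 1) * (64 * M) := Finset.sum_le_sum hwin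
    _ = 256 * M * ∑ n ∈ Finset.range (N₀ + 1), 1 / ((n : ℝ) + 1) := by
        rw [Finset.mul_sum]
        refine Finset.sum_congr rfl fun n _ ↦ ?_
        ring
    _ ≤ 256 * M * (1 + Real.log (U + 2)) := mul_le_mul_of_nonneg_left hharm (by positivity)
    _ = 256 * discBound K (U + 1) * (1 + Real.log (U + 2)) := by rw [hM]

/-- The order of an analytic function at a point, as an integer, is nonnegative. [folklore] -/
theorem untop₀_meromorphicOrderAt_nonneg {f : ℂ → ℂ} {z : ℂ} (hf : AnalyticAt ℂ f z) :
    0 ≤ (meromorphicOrderAt f z).untop₀ := by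
  rw [hf.meromorphicOrderAt_eq]
  cases analyticOrderAt f z with
  | top => simp
  | coe n => simp

/-- Elementary: for `x ≥ 7/2`, `log(x + 11) ≤ 3 log x` (as `x + 11 ≤ x³`). [folklore] -/
lemma log_add_eleven_le {x : ℝ} (hx : 7 / 2 ≤ x) : Real.log (x + 11) ≤ 3 * Real.log x := by
  have h : x + 11 ≤ x ^ 3 := by nlinarith [sq_nonneg x, mul_pos (by linarith : (0:ℝ) < x) (by linarith : (0:ℝ) < x)]
  calc Real.log (x + 11) ≤ Real.log (x ^ 3) := Real.log_le_log (by linarith) h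
    _ = 3 * Real.log x := by rw [Real.log_pow]; push_cast; ring

/-- The disc bound at height `≤ √x + 4` against `L = log|d_K| + n_K log x`: for `x ≥ 7/2` and
`|t| ≤ √x + 4`, `M_K(t) ≤ 9 (log|d_K| + n_K log x)`. [folklore] -/
theorem discBound_le_nine_mul {x t : ℝ} (hx : 7 / 2 ≤ x) (ht : |t| ≤ Real.sqrt x + 4) :
    discBound K t ≤ 9 * (Real.log |(NumberField.discr K : ℝ)| + Module.finrank ℚ K * Real.log x) := by
  have hx1 : 1 ≤ x := by linarith
  have hlogx : 1 ≤ Real.log x := by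
    rw [← Real.log_exp 1]
    exact Real.log_le_log (Real.exp_pos 1) (by have := Real.exp_one_lt_d9; linarith)
  have hsx : Real.sqrt x ≤ x := Real.sqrt_le_iff.mpr ⟨by linarith, by nlinarith⟩
  have hlogt : Real.log (|t| + 7) ≤ 3 * Real.log x :=
    (Real.log_le_log (by linarith [abs_nonneg t]) (by linarith)).trans (log_add_eleven_le hx)
  have hd : Real.log ((NumberField.discr K).natAbs : ℝ) = Real.log |(NumberField.discr K : ℝ)| := by
    rw [Nat.cast_natAbs, Int.cast_abs]
  have hd0 : 0 ≤ Real.log |(NumberField.discr K : ℝ)| := by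
    refine Real.log_nonneg ?_
    have h1 : (1 : ℤ) ≤ |NumberField.discr K| := Int.one_le_abs (NumberField.discr_ne_zero K)
    exact_mod_cast h1
  have hn : (1 : ℝ) ≤ Module.finrank ℚ K := by exact_mod_cast Module.finrank_pos (R := ℚ) (M := K)
  unfold discBound
  rw [hd]
  set n : ℝ := (Module.finrank ℚ K : ℝ)
  set L : ℝ := Real.log x
  have h1 : (n + 1) * Real.log (|t| + 7) ≤ (n + 1) * (3 * L) :=
    mul_le_mul_of_nonneg_left hlogt (by positivity)
  have h2 : 3 * n ≤ 3 * (n * L) := by nlinarith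
  have h3 : (n + 1) * (3 * L) ≤ 6 * (n * L) := by nlinarith
  nlinarith

end Field

section Main

set_option maxHeartbeats 800000 in
/-- **GRH implies `ψ_K(x) = x + O(√x log x (log|d_K| + n_K log x))` at half-integers, uniformly in
`K`** (Lagarias–Odlyzko 1977, Thm. 9.1 under GRH, `L = K`; Winckler 2013, Thm. 8.1): there is an
absolute `C` such that for every number field `K` satisfying ERH and every `x = N + 1/2`, `N ≥ 3`,
`|ψ_K(x) − x| ≤ C √x log x (log|d_K| + [K:ℚ] log x)`. [cite: LagariasOdlyzko1977, Thm. 9.1] -/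
theorem exists_abs_chebyshevPsiIdeal_sub_le_halfInt :
    ∃ C : ℝ, 0 < C ∧ ∀ (K : Type*) [Field K] [NumberField K],
      NumberField.ExtendedRiemannHypothesis K → ∀ N : ℕ, 3 ≤ N →
        |NumberField.chebyshevPsiIdeal K ((N : ℝ) + 1 / 2) - ((N : ℝ) + 1 / 2)| ≤
          C * Real.sqrt ((N : ℝ) + 1 / 2) * Real.log ((N : ℝ) + 1 / 2) *
            (Real.log |(NumberField.discr K : ℝ)| +
              Module.finrank ℚ K * Real.log ((N : ℝ) + 1 / 2)) := by
  obtain ⟨A, hA0, hA⟩ := NumberField.exists_norm_perron_vonMangoldtIdeal_sub_le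
  refine ⟨A + 2 * (155778 * 9 * Real.exp 1) + 77890 * 9 * 200 + 256 * 9 * 3, by positivity,
    fun K _ _ hERH N hN ↦ ?_⟩
  set x : ℝ := (N : ℝ) + 1 / 2 with hxdef
  set c : ℝ := 1 + 1 / Real.log x with hcdef
  obtain ⟨hx0, hlog, hc1, hc2, hxc, hfloor⟩ := halfInt_facts (x := x) (c := c) hN hxdef hcdef
  have hN' : (3 : ℝ) ≤ N := by exact_mod_cast hN
  have hx72 : 7 / 2 ≤ x := by rw [hxdef]; linarith
  have hx1 : 1 ≤ x := by linarith
  have e14 : ((1 / 4 : ℝ) : ℂ) = 1 / 4 := by push_cast; ring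
  set f := dedekindZeta₁ K with hf
  -- the parameters
  set sx : ℝ := Real.sqrt x with hsx
  have hsx1 : 1 ≤ sx := Real.one_le_sqrt.mpr hx1
  have hsxx : sx ≤ x := Real.sqrt_le_iff.mpr ⟨by linarith, by nlinarith⟩
  have hxsx : x / sx = sx := Real.div_sqrt
  set T₀ : ℝ := sx + 2 with hT₀
  have hT₀3 : 3 ≤ T₀ := by linarith
  have hT₀0 : 0 < T₀ := by linarith
  set L : ℝ := Real.log |(NumberField.discr K : ℝ)| + Module.finrank ℚ K * Real.log x with hL
  set Lx : ℝ := Real.log x with hLx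
  have hL1 : 1 ≤ Lx := hlog
  have hd0 : 0 ≤ Real.log |(NumberField.discr K : ℝ)| := by
    refine Real.log_nonneg ?_
    have h1 : (1 : ℤ) ≤ |NumberField.discr K| := Int.one_le_abs (NumberField.discr_ne_zero K)
    exact_mod_cast h1
  have hn1 : (1 : ℝ) ≤ Module.finrank ℚ K := by exact_mod_cast Module.finrank_pos (R := ℚ) (M := K)
  have hLxL : Lx ≤ L := by
    have : Lx ≤ Module.finrank ℚ K * Lx := le_mul_of_one_le_left (by linarith) hn1
    rw [hL]; linarith
  have hL0 : 0 ≤ L := by linarith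
  -- the disc bounds at all relevant heights are `≤ 9 L`
  have hM9 : ∀ t : ℝ, |t| ≤ T₀ + 2 → discBound K t ≤ 9 * L := fun t ht ↦
    discBound_le_nine_mul K hx72 (by rw [hT₀] at ht; linarith)
  -- heights `T₁ ∈ [T₀, T₀+1]`, `T₂ ∈ [−T₀−1, −T₀]` avoiding the ordinates of zeros
  obtain ⟨T₁, hT₁mem, hT₁z⟩ := exists_height_not_ordinate K T₀
  obtain ⟨T₂, hT₂mem, hT₂z⟩ := exists_height_not_ordinate K (-T₀ - 1)
  have hT₁x : T₀ ≤ T₁ := hT₁mem.1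
  have hT₁x' : T₁ ≤ T₀ + 1 := hT₁mem.2
  have hT₂x : -T₀ - 1 ≤ T₂ := hT₂mem.1
  have hT₂x' : T₂ ≤ -T₀ := by have := hT₂mem.2; linarith
  have hlo : T₂ < 0 := by linarith
  have hhi : 0 < T₁ := by linarith
  have hT₁abs : |T₁| = T₁ := abs_of_pos hhi
  have hT₂abs : |T₂| = -T₂ := abs_of_neg hlo
  -- no zeros on the horizontal lines at heights `T₁`, `T₂` with `0 < σ < 3`
  have hnoz : ∀ {T : ℝ}, (∀ ρ : ℂ, f ρ = 0 → 0 < ρ.re → ρ.re < 3 → ρ.im ≠ T) →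
      ∀ σ : ℝ, 0 < σ → σ < 3 → f ((σ : ℂ) + T * I) ≠ 0 := by
    intro T hT σ h0 h3 hz
    exact hT _ hz (by simp; exact h0) (by simp; exact h3) (by simp)
  have h_bot : ∀ σ ∈ Icc (1 / 4 : ℝ) c, f (σ + T₂ * I) ≠ 0 := fun σ hσ ↦
    hnoz hT₂z σ (by linarith [hσ.1]) (by linarith [hσ.2])
  have h_top : ∀ σ ∈ Icc (1 / 4 : ℝ) c, f (σ + T₁ * I) ≠ 0 := fun σ hσ ↦
    hnoz hT₁z σ (by linarith [hσ.1]) (by linarith [hσ.2])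
  have h_left : ∀ t ∈ Icc T₂ T₁, f ((1 / 4 : ℝ) + t * I) ≠ 0 := by
    intro t _ h0
    have h14 := re_eq_one_half_of_erh hERH h0 (by simp)
    have hre : (((1 / 4 : ℝ) : ℂ) + t * I).re = 1 / 4 := by simp
    rw [hre] at h14
    norm_num at h14
  have h_right : ∀ t ∈ Icc T₂ T₁, f (c + t * I) ≠ 0 := fun t _ ↦
    dedekindZeta₁_ne_zero_of_one_le_re (by simp; exact hc1.le)
  have hz₁ : f (1 / 2 + T₁ * I) ≠ 0 := by
    have := hnoz hT₁z (1 / 2) (by norm_num) (by norm_num)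
    push_cast at this
    exact this
  have hz₂ : f (1 / 2 + T₂ * I) ≠ 0 := by
    have := hnoz hT₂z (1 / 2) (by norm_num) (by norm_num)
    push_cast at this
    exact this
  -- (1) the residue identity
  have hId := rectBoundaryIntegral_dedekindVonKoch_eq K hx0 (by norm_num : (0 : ℝ) < 1 / 4)
    (by norm_num : (1 / 4 : ℝ) < 1) hc1 hlo hhi h_bot h_top h_left h_right
  rw [Literature.Analysis.Complex.rectBoundaryIntegral_def] at hId
  -- (2) the right side: truncated Perron
  have hRψ : ‖(∫ t in T₂..T₁, (fun s : ℂ ↦ (-(deriv f s / f s) + (s - 1)⁻¹) *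
      ((x : ℂ) ^ s / s)) (c + t * I)) - 2 * π * NumberField.chebyshevPsiIdeal K x‖ ≤
      A * Module.finrank ℚ K * x * Real.log x ^ 2 / T₀ := by
    have hRe : (∫ t in T₂..T₁, (fun s : ℂ ↦ (-(deriv f s / f s) + (s - 1)⁻¹) *
        ((x : ℂ) ^ s / s)) (c + t * I)) =
        ∫ t in T₂..T₁, LSeries (fun n ↦ (NumberField.vonMangoldtIdeal K n : ℂ)) (c + t * I) *
          ((x : ℂ) ^ ((c : ℂ) + t * I) / ((c : ℂ) + t * I)) :=
      integral_congr fun t _ ↦ dedekindVonKochIntegrand_eq_of_one_lt K x hc1 t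
    rw [hRe]
    have hP := hA K N hN x c hxdef hcdef T₀ T₁ (-T₂) hT₀0 hT₁x (by linarith)
    rw [neg_neg] at hP
    exact hP
  -- (3) horizontal sides
  have hTn := norm_dedekindVonKoch_horizontal_le K hERH hx1 hc1 hc2 hxc
    (by rw [hT₁abs]; linarith) hz₁
  have hBn := norm_dedekindVonKoch_horizontal_le K hERH hx1 hc1 hc2 hxc
    (by rw [hT₂abs]; linarith) hz₂
  -- (4) left side
  have hLn := norm_dedekindVonKoch_left_le K hERH (lo := T₂) (hi := T₁) (A := T₀ + 1) hx1
    (by linarith) (by linarith) (hlo.trans hhi).le hT₁x'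
  -- (5) the zero sum
  have hfA : AnalyticOnNhd ℂ f (Icc (1 / 4 : ℝ) c ×ℂ Icc T₂ T₁) := fun s _ ↦
    (dedekindZeta₁_differentiable K).analyticAt s
  have hcorner : ((1 / 4 : ℝ) : ℂ) + T₂ * I ∈ Icc (1 / 4 : ℝ) c ×ℂ Icc T₂ T₁ := by
    have hre : (((1 / 4 : ℝ) : ℂ) + T₂ * I).re = 1 / 4 := by simp
    have him : (((1 / 4 : ℝ) : ℂ) + T₂ * I).im = T₂ := by simp
    rw [mem_reProdIm, hre, him]
    exact ⟨⟨le_rfl, by linarith⟩, ⟨le_rfl, by linarith⟩⟩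
  have hfin := Literature.Analysis.Complex.finite_zeros_reProdIm (f := f)
    (by linarith : (1 / 4 : ℝ) ≤ c) (hlo.trans hhi).le hfA hcorner (h_left T₂ ⟨le_rfl, by linarith⟩)
  have hSn : ‖∑ᶠ ρ ∈ {ρ : ℂ | f ρ = 0 ∧ ρ ∈ Ioo (1 / 4 : ℝ) c ×ℂ Ioo T₂ T₁},
      ((meromorphicOrderAt f ρ).untop₀ : ℂ) * ((x : ℂ) ^ ρ / ρ)‖ ≤
      sx * (256 * discBound K (T₀ + 1 + 1) * (1 + Real.log (T₀ + 1 + 2))) := by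
    rw [finsum_mem_eq_finite_toFinset_sum _ hfin]
    set Fz := hfin.toFinset with hFz
    have hmem : ∀ ρ ∈ Fz, f ρ = 0 ∧ ρ ∈ Ioo (1 / 4 : ℝ) c ×ℂ Ioo T₂ T₁ := fun ρ hρ ↦ by
      simpa [hFz] using hρ
    have hFz' : ∀ ρ ∈ Fz, f ρ = 0 ∧ 0 < ρ.re ∧ |ρ.im| ≤ T₀ + 1 := by
      intro ρ hρ
      obtain ⟨h0, hm⟩ := hmem ρ hρ
      have h' := mem_reProdIm.1 hm
      refine ⟨h0, by linarith [h'.1.1], ?_⟩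
      rw [abs_le]; constructor <;> linarith [h'.2.1, h'.2.2]
    have hre : ∀ ρ ∈ Fz, ρ.re = 1 / 2 := fun ρ hρ ↦
      re_eq_one_half_of_erh hERH (hFz' ρ hρ).1 (hFz' ρ hρ).2.1
    have hterm : ∀ ρ ∈ Fz, ‖((meromorphicOrderAt f ρ).untop₀ : ℂ) * ((x : ℂ) ^ ρ / ρ)‖ =
        sx * (((meromorphicOrderAt f ρ).untop₀ : ℝ) / ‖ρ‖) := by
      intro ρ hρ
      have hm : (0 : ℝ) ≤ (meromorphicOrderAt f ρ).untop₀ := by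
        exact_mod_cast untop₀_meromorphicOrderAt_nonneg ((dedekindZeta₁_differentiable K).analyticAt ρ)
      rw [norm_mul, Complex.norm_intCast, abs_of_nonneg hm, norm_div,
        Complex.norm_cpow_eq_rpow_re_of_pos hx0, hre ρ hρ, hsx, Real.sqrt_eq_rpow]
      ring
    calc ‖∑ ρ ∈ Fz, ((meromorphicOrderAt f ρ).untop₀ : ℂ) * ((x : ℂ) ^ ρ / ρ)‖
        ≤ ∑ ρ ∈ Fz, ‖((meromorphicOrderAt f ρ).untop₀ : ℂ) * ((x : ℂ) ^ ρ / ρ)‖ := norm_sum_le _ _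
      _ = ∑ ρ ∈ Fz, sx * (((meromorphicOrderAt f ρ).untop₀ : ℝ) / ‖ρ‖) := Finset.sum_congr rfl hterm
      _ = sx * ∑ ρ ∈ Fz, ((meromorphicOrderAt f ρ).untop₀ : ℝ) / ‖ρ‖ := by rw [Finset.mul_sum]
      _ ≤ sx * (256 * discBound K (T₀ + 1 + 1) * (1 + Real.log (T₀ + 1 + 2))) :=
          mul_le_mul_of_nonneg_left
            (sum_zeroOrder_div_norm_le_of_erh K hERH (U := T₀ + 1) (by linarith) Fz hFz')
            (by positivity)
  -- (6) combine
  have hfinal := abs_sub_le_of_vonKoch_identity hId hTn hBn hRψ hLn hSn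
  -- (7) bookkeeping: everything is `≪ √x log x · L`
  set n : ℝ := (Module.finrank ℚ K : ℝ) with hn
  have hsL : 0 ≤ sx * Lx * L := by positivity
  -- Perron
  have hR' : A * n * x * Real.log x ^ 2 / T₀ ≤ A * (sx * Lx * L) := by
    have h1 : A * n * x * Real.log x ^ 2 / T₀ ≤ A * n * x * Real.log x ^ 2 / sx :=
      div_le_div_of_nonneg_left (by positivity) (by linarith) (by linarith)
    have hxss : x = sx * sx := by rw [hsx]; exact (Real.mul_self_sqrt hx0.le).symm
    have h2 : A * n * x * Real.log x ^ 2 / sx = A * (sx * Lx * (n * Lx)) := by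
      rw [← hLx, hxss]
      field_simp
    have h3 : n * Lx ≤ L := by rw [hL]; linarith
    calc A * n * x * Real.log x ^ 2 / T₀ ≤ A * (sx * Lx * (n * Lx)) := by rw [← h2]; exact h1
      _ ≤ A * (sx * Lx * L) := by gcongr
  -- auxiliary logarithms
  have hlog5 : Real.log (x + 5) ≤ 2 * Lx := log_add_five_le hx72
  have hlogT2 : Real.log (T₀ + 1 + 1) ≤ 2 * Lx :=
    (Real.log_le_log (by linarith) (by rw [hT₀]; linarith)).trans hlog5
  have hlogT3 : Real.log (T₀ + 1 + 2) ≤ 2 * Lx :=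
    (Real.log_le_log (by linarith) (by rw [hT₀]; linarith)).trans hlog5
  have hx14 : x ^ (1 / 4 : ℝ) ≤ sx := by
    rw [hsx, Real.sqrt_eq_rpow]
    exact Real.rpow_le_rpow_of_exponent_le hx1 (by norm_num)
  have hLsx : L * sx ≤ sx * Lx * L := by
    have h := mul_nonneg (mul_nonneg (by linarith : (0 : ℝ) ≤ sx) hL0) (by linarith : (0 : ℝ) ≤ Lx - 1)
    calc L * sx = sx * Lx * L - sx * L * (Lx - 1) := by ring
      _ ≤ sx * Lx * L := by linarith [h]
  -- horizontal sides
  have hH : ∀ {T : ℝ}, T₀ ≤ |T| → |T| ≤ T₀ + 1 →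
      155778 * Real.exp 1 * discBound K T * x / (|T| - 1) ≤
        155778 * 9 * Real.exp 1 * (sx * Lx * L) := by
    intro T hTa hTb
    have hM := hM9 T (by linarith)
    have hq : x / (|T| - 1) ≤ sx := by
      calc x / (|T| - 1) ≤ x / sx := div_le_div_of_nonneg_left hx0.le (by linarith) (by linarith)
        _ = sx := hxsx
    have hq0 : 0 ≤ x / (|T| - 1) := div_nonneg hx0.le (by linarith)
    have hM0 : 0 ≤ discBound K T := discBound_nonneg K T
    calc 155778 * Real.exp 1 * discBound K T * x / (|T| - 1)
        = 155778 * Real.exp 1 * discBound K T * (x / (|T| - 1)) := by ring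
      _ ≤ 155778 * Real.exp 1 * (9 * L) * sx :=
          mul_le_mul (mul_le_mul_of_nonneg_left hM (by positivity)) hq hq0 (by positivity)
      _ = 155778 * 9 * Real.exp 1 * (L * sx) := by ring
      _ ≤ 155778 * 9 * Real.exp 1 * (sx * Lx * L) :=
          mul_le_mul_of_nonneg_left hLsx (by positivity)
  have hT' := hH (T := T₁) (by rw [hT₁abs]; exact hT₁x) (by rw [hT₁abs]; exact hT₁x')
  have hB' := hH (T := T₂) (by rw [hT₂abs]; linarith) (by rw [hT₂abs]; linarith)
  -- left side
  have hL' : x ^ (1 / 4 : ℝ) * (77890 * discBound K (T₀ + 1)) * (10 * Real.log (T₀ + 1 + 1)) ≤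
      77890 * 9 * 20 * (sx * Lx * L) := by
    have hM := hM9 (T₀ + 1) (by rw [abs_of_nonneg (by linarith)]; linarith)
    have hM0 : 0 ≤ discBound K (T₀ + 1) := discBound_nonneg K _
    have hlog0 : 0 ≤ Real.log (T₀ + 1 + 1) := Real.log_nonneg (by linarith)
    calc x ^ (1 / 4 : ℝ) * (77890 * discBound K (T₀ + 1)) * (10 * Real.log (T₀ + 1 + 1))
        ≤ sx * (77890 * (9 * L)) * (10 * (2 * Lx)) := by
          refine mul_le_mul (mul_le_mul hx14 (by linarith) (by positivity) (by positivity)) ?_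
            (by positivity) (by positivity)
          linarith
      _ = 77890 * 9 * 20 * (sx * Lx * L) := by ring
  -- zero sum
  have hS' : sx * (256 * discBound K (T₀ + 1 + 1) * (1 + Real.log (T₀ + 1 + 2))) ≤
      256 * 9 * 3 * (sx * Lx * L) := by
    have hM := hM9 (T₀ + 1 + 1) (by rw [abs_of_nonneg (by linarith)]; linarith)
    have hM0 : 0 ≤ discBound K (T₀ + 1 + 1) := discBound_nonneg K _
    have h13 : 1 + Real.log (T₀ + 1 + 2) ≤ 3 * Lx := by linarith
    have hlog0 : 0 ≤ 1 + Real.log (T₀ + 1 + 2) := by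
      have := Real.log_nonneg (by linarith : (1 : ℝ) ≤ T₀ + 1 + 2); linarith
    calc sx * (256 * discBound K (T₀ + 1 + 1) * (1 + Real.log (T₀ + 1 + 2)))
        ≤ sx * (256 * (9 * L) * (3 * Lx)) := by
          refine mul_le_mul_of_nonneg_left ?_ (by positivity)
          exact mul_le_mul (by linarith) h13 hlog0 (by positivity)
      _ = 256 * 9 * 3 * (sx * Lx * L) := by ring
  -- conclusion
  calc |NumberField.chebyshevPsiIdeal K x - x| ≤ _ := hfinal
    _ ≤ (A + 2 * (155778 * 9 * Real.exp 1) + 77890 * 9 * 200 + 256 * 9 * 3) * (sx * Lx * L) := by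
        linarith [hT', hB', hR', hL', hS', hsL, Real.exp_pos 1, hA0.le]
    _ = _ := by ring

/-- `ψ_K(x) ≤ [K:ℚ] (x + 1) log x` for `x ≥ 1` (each of the `⌊x⌋ + 1` terms has
`Λ_K(n) ≤ [K:ℚ] log n ≤ [K:ℚ] log x`). [folklore] -/
theorem chebyshevPsiIdeal_le_finrank_mul (K : Type*) [Field K] [NumberField K] {x : ℝ} (hx : 1 ≤ x) :
    NumberField.chebyshevPsiIdeal K x ≤ Module.finrank ℚ K * (x + 1) * Real.log x := by
  have hx0 : 0 < x := by linarith
  have hlog0 : 0 ≤ Real.log x := Real.log_nonneg hx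
  have hterm : ∀ n ∈ Finset.Icc 0 ⌊x⌋₊,
      NumberField.vonMangoldtIdeal K n ≤ Module.finrank ℚ K * Real.log x := by
    intro n hn
    rw [Finset.mem_Icc] at hn
    refine (NumberField.vonMangoldtIdeal_le_finrank_mul_log K n).trans
      (mul_le_mul_of_nonneg_left ?_ (Nat.cast_nonneg _))
    rcases Nat.eq_zero_or_pos n with rfl | hn0
    · simp [hlog0]
    · exact Real.log_le_log (by exact_mod_cast hn0) ((Nat.le_floor_iff hx0.le).1 hn.2)
  unfold NumberField.chebyshevPsiIdeal
  calc ∑ n ∈ Finset.Icc 0 ⌊x⌋₊, NumberField.vonMangoldtIdeal K n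
      ≤ ∑ n ∈ Finset.Icc 0 ⌊x⌋₊, (Module.finrank ℚ K * Real.log x) := Finset.sum_le_sum hterm
    _ = (⌊x⌋₊ + 1 : ℝ) * (Module.finrank ℚ K * Real.log x) := by
        rw [Finset.sum_const, Nat.card_Icc, nsmul_eq_mul]
        push_cast
        ring
    _ ≤ (x + 1) * (Module.finrank ℚ K * Real.log x) := by
        have : (⌊x⌋₊ : ℝ) ≤ x := Nat.floor_le hx0.le
        exact mul_le_mul_of_nonneg_right (by linarith) (by positivity)
    _ = Module.finrank ℚ K * (x + 1) * Real.log x := by ring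

/-- **GRH implies `|ψ_K(x) − x| ≤ c √x log x (log|d_K| + [K:ℚ] log x)` for all `x ≥ 2`, with an
absolute `c`** (Lagarias–Odlyzko 1977, Thm. 9.1 for `L = K` under GRH; Winckler 2013, Thm. 8.1;
the `ψ`-form of Serre 1981, Thm. 4): from the half-integer case, since `ψ_K` is constant on
`[N, N + 1)`, and trivially for `2 ≤ x < 4`. This is exactly the hypothesis of
`NumberField.effectivePrimeIdealTheorem_of_ERH_of_chebyshevPsiIdeal`. [cite: LagariasOdlyzko1977, Thm. 9.1] -/
theorem exists_abs_chebyshevPsiIdeal_sub_self_le_of_erh :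
    ∃ c : ℝ, 0 < c ∧ ∀ (K : Type) [Field K] [NumberField K],
      NumberField.ExtendedRiemannHypothesis K → ∀ x : ℝ, 2 ≤ x →
        |NumberField.chebyshevPsiIdeal K x - x| ≤
          c * Real.sqrt x * Real.log x *
            (Real.log |(NumberField.discr K : ℝ)| + Module.finrank ℚ K * Real.log x) := by
  obtain ⟨C, hC0, hC⟩ := exists_abs_chebyshevPsiIdeal_sub_le_halfInt
  refine ⟨8 * C + 1 + 26, by positivity, fun K _ _ hERH x hx ↦ ?_⟩
  have hx0 : 0 < x := by linarith
  have hlog2 : (1 / 2 : ℝ) < Real.log 2 := by have := Real.log_two_gt_d9; linarith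
  have hlogx : Real.log 2 ≤ Real.log x := Real.log_le_log two_pos hx
  have hlogx0 : 0 < Real.log x := by linarith
  have hsx1 : 1 ≤ Real.sqrt x := Real.one_le_sqrt.mpr (by linarith)
  have hd0 : 0 ≤ Real.log |(NumberField.discr K : ℝ)| := by
    refine Real.log_nonneg ?_
    have h1 : (1 : ℤ) ≤ |NumberField.discr K| := Int.one_le_abs (NumberField.discr_ne_zero K)
    exact_mod_cast h1
  have hn1 : (1 : ℝ) ≤ Module.finrank ℚ K := by exact_mod_cast Module.finrank_pos (R := ℚ) (M := K)
  set n : ℝ := (Module.finrank ℚ K : ℝ) with hn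
  set d : ℝ := Real.log |(NumberField.discr K : ℝ)| with hd
  set L : ℝ := d + n * Real.log x with hL
  have hLlog : Real.log x ≤ L := by
    have : Real.log x ≤ n * Real.log x := le_mul_of_one_le_left hlogx0.le hn1
    rw [hL]; linarith
  have hL12 : 1 / 2 ≤ L := by linarith
  set P : ℝ := Real.sqrt x * Real.log x * L with hP
  have hP0 : 0 ≤ P := by positivity
  -- `1 ≤ 4 P` (as `√x ≥ 1`, `log x ≥ 1/2`, `L ≥ 1/2`)
  have hP1 : 1 ≤ 4 * P := by
    have h1 : 1 / 2 ≤ Real.sqrt x * Real.log x := by nlinarith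
    have h2 : 0 ≤ Real.sqrt x * Real.log x := by positivity
    rw [hP]; nlinarith
  by_cases h4 : x < 4
  · -- small `x`: `ψ_K(x) ≤ 5 n log x ≤ 10 P`, `x ≤ 4 ≤ 16 P`
    have hψ0 : 0 ≤ NumberField.chebyshevPsiIdeal K x := NumberField.chebyshevPsiIdeal_nonneg K x
    have hψ : NumberField.chebyshevPsiIdeal K x ≤ 10 * P := by
      have h1 := chebyshevPsiIdeal_le_finrank_mul K (x := x) (by linarith)
      have h2 : n * (x + 1) * Real.log x ≤ 5 * (n * Real.log x) := by
        have : 0 ≤ n * Real.log x := by positivity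
        nlinarith
      have h3 : n * Real.log x ≤ L := by rw [hL]; linarith
      have h5 : L ≤ 2 * P := by
        have : 1 / 2 ≤ Real.sqrt x * Real.log x := by nlinarith
        rw [hP]; nlinarith
      linarith
    rw [abs_le]
    constructor <;> nlinarith
  · -- `x ≥ 4`: compare with the half-integer `x' = ⌊x⌋ + 1/2`
    push Not at h4
    obtain ⟨N, hNdef⟩ : ∃ N : ℕ, ⌊x⌋₊ = N := ⟨_, rfl⟩
    have hN3 : 3 ≤ N := by rw [← hNdef]; exact Nat.le_floor (by push_cast; linarith)
    have hNx : (N : ℝ) ≤ x := by rw [← hNdef]; exact Nat.floor_le hx0.le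
    have hxN : x < N + 1 := by rw [← hNdef]; exact Nat.lt_floor_add_one x
    set x' : ℝ := (N : ℝ) + 1 / 2 with hx'
    have hx'0 : 0 < x' := by rw [hx']; positivity
    have hfloor' : ⌊x'⌋₊ = N := by
      rw [hx', Nat.floor_eq_iff (by positivity)]
      constructor <;> linarith
    have hψ : NumberField.chebyshevPsiIdeal K x = NumberField.chebyshevPsiIdeal K x' := by
      unfold NumberField.chebyshevPsiIdeal
      rw [hfloor', hNdef]
    have hmain := hC K hERH N hN3
    -- compare `x'` with `x`
    have hxx' : |x' - x| ≤ 1 / 2 := by rw [abs_le]; constructor <;> linarith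
    have hx'le : x' ≤ 4 * x := by linarith
    have hsqrt : Real.sqrt x' ≤ 2 * Real.sqrt x := by
      calc Real.sqrt x' ≤ Real.sqrt (4 * x) := Real.sqrt_le_sqrt hx'le
        _ = Real.sqrt 4 * Real.sqrt x := Real.sqrt_mul (by norm_num) x
        _ = 2 * Real.sqrt x := by
            rw [show (4 : ℝ) = 2 ^ 2 by norm_num, Real.sqrt_sq (by norm_num)]
    have hlogx' : Real.log x' ≤ 2 * Real.log x := by
      calc Real.log x' ≤ Real.log (2 * x) := Real.log_le_log hx'0 (by linarith)
        _ = Real.log 2 + Real.log x := Real.log_mul two_ne_zero hx0.ne'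
        _ ≤ 2 * Real.log x := by linarith
    have hlogx'0 : 0 ≤ Real.log x' := Real.log_nonneg (by linarith)
    have hL' : d + n * Real.log x' ≤ 2 * L := by
      have : n * Real.log x' ≤ n * (2 * Real.log x) := mul_le_mul_of_nonneg_left hlogx' (by linarith)
      rw [hL]; nlinarith
    have hL'0 : 0 ≤ d + n * Real.log x' := by positivity
    have h1 : C * Real.sqrt x' * Real.log x' * (d + n * Real.log x') ≤ 8 * C * P := by
      calc C * Real.sqrt x' * Real.log x' * (d + n * Real.log x')
          ≤ C * (2 * Real.sqrt x) * (2 * Real.log x) * (2 * L) := by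
            refine mul_le_mul (mul_le_mul (mul_le_mul_of_nonneg_left hsqrt hC0.le) hlogx' hlogx'0
              (by positivity)) hL' hL'0 (by positivity)
        _ = 8 * C * P := by rw [hP]; ring
    calc |NumberField.chebyshevPsiIdeal K x - x|
        = |(NumberField.chebyshevPsiIdeal K x' - x') + (x' - x)| := by rw [hψ]; ring_nf
      _ ≤ |NumberField.chebyshevPsiIdeal K x' - x'| + |x' - x| := abs_add_le _ _
      _ ≤ C * Real.sqrt x' * Real.log x' * (d + n * Real.log x') + 1 / 2 := add_le_add hmain hxx'
      _ ≤ 8 * C * P + 4 * P := by linarith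
      _ ≤ (8 * C + 1 + 26) * P := by nlinarith
      _ = (8 * C + 1 + 26) * Real.sqrt x * Real.log x * (d + n * Real.log x) := by rw [hP, hL]; ring

end Main

end Literature.NumberTheory.LFunctions

end
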